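/- Copyright: the b2b-balaban cell (near-miss cell 7), T⁴-continuum fan-out; row NE7b CRUX team (2), seat
t4-ne7b-formalise-leaf-05 (gen 32) — the row OWNER's SPEC IR-46-2 «THE (α) ASSEMBLY» v0 l.15 «… leaf-05 toy», part 3 of 3
(`CLAIMS.log` l.32475 ∕ l.32701).  Released under the licence of the surrounding project. -/
import Summits.QuantumFields.BalabanUV.T4Continuum.Support.HistoryRealiseCellsRunAssemblyWTVSSanityEnd
import Summits.QuantumFields.BalabanUV.T4Continuum.Support.HistoryRealiseCellsRunApexWitness
import Summits.QuantumFields.BalabanUV.T4Continuum.Support.HistoryRealiseCellsRunApexT3bWTVSL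

/-!
# Sanity for the (α) assembly, part 3: `HistReadData` HAS A KERNEL INHABITANT — ALL 103 FIELDS DISCHARGED, NO HYPOTHESIS —
ON THE CELL's TOY DATUM × THE NO-REGION TOY READING, AND FILE 2's END THEN YIELDS A VS-WITNESS (AND AN L-WITNESS) THROUGH
THE ASSEMBLY ROAD (companion of `HistoryRealiseCellsRunAssemblyWTVSData` ∕ `…AssemblyWTVS`; SPEC IR-46-2 v0 «leaf-05 toy»,
lineage `t4-ne7b-formalise-leaf-05` gen 32)

Summits-side support leaf of the T⁴-continuum cell (rung (B)+1 on a FINITE torus only; NOT infinite volume, NOT the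
mass gap, NOT Clay; NOT a proof of NE7b — the cell's OWN estimate, NOT PRINTED, NOT PROVED).  [decided toy] over parts
1–2 (`histReadData₃`, `budget_toyR`, `shell_toyR`, `ZD`) and leaf-09∕leaf-06's toy datum `toyData F G`
(`HistoryRealiseCellsRunApexWitness`: the χ := 1 twin of the placeholder construction — constant coupling flow, zero
site counts, small-field mass `1`, Boltzmann initial density; **(B) FAILS there**, `not_endStatementBPrinted_toy`), REUSED
BY NAME; nothing printed asserted, no `def … : Prop` fact, no cite-tagged hypothesis, zero `sorry`.

WHAT.  At bare couplings **`gE ≡ e^{−1}`** (so `log gE⁻² = 2` and (2.5) with exponent `rr = 1` picks exactly the size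
`F.L = F.L¹`: `isRj_toyData`), the EMPTY loop string (product observable `1`: `ZD_toyData_nil : ZD (toyData F G) g₀ [] K t =
e^t · ZD … K 0`) and the Boltzmann initial density (`ZD_toyData_zero_le_one`: `∫ e^{−A∕g²} ≤ 1` on the probability Haar
measure) — part 2's displayed inputs are DISCHARGED: `hM := measurable_toyAv`, `hZ` at `Zi := e` (`ZD_toyData_le`),
`isRj`, `floor`∕`floor′` at `c₀ := 1` (`smallFieldMass_toy`), `sites`∕`sites′` at `n₁ := 0` (`toy_numSites`), NE7's socket
by `budget_toyR` at the `t`-free class constant `ν K := log (ZD … (K+1) 0 ∕ ZD … K 0)` (`ZD_toyData_succ`), NE7c's by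
`shell_toyR`.  Hence **`nonempty_histReadData_toyData : Nonempty (HistReadData (toyData F G) C₂ O₁ θᵥ 1 1 n hn gE [] Isk Isk
_ μ₀ _ _ μ₀ _)`** — FILE 1's record, ALL 103 FIELDS, NO HYPOTHESIS — and through FILE 2's END
**`nonempty_countRoadWitnessT3bWTVS_toyData`**, and through the owner's L3a embedding `nonempty_countRoadWitnessT3bWTVSL_of`
(p283603) **`nonempty_countRoadWitnessT3bWTVSL_toyData`**: the ASSEMBLY ROAD is inhabited END TO END on a datum (a third,
independent inhabitation road for the VS-witness shape after leaf-09's `toyWitnessT3bOf` and leaf-06's transports in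
`HistoryRealiseCellsRunApexWitnessT3bWTVS`; index types here `HIndex.Idx Isk`, `ℕ × Lab 1`, `Lab 1` — the assembly's own).

R-OWNER-48-1 «THE GUARDED CUT» (`CLAIMS.log` l.32451).  Precisely located: `HistReadData` is uninhabitable AS TYPED for
readings WITH a live join (unguarded `hDJ`); on the NO-REGION reading it IS inhabited (this file) — the boundary is the
join clause and nothing else.  The `HistReadDataL` ∕ L5 twins follow by the custodian's `HistReadData.toL` when L5 lands.

HONEST.  A node test of a hypothesis SHAPE on a decided toy where (B) FAILS: NO instance of `HybridNE7Under` ∕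
`ContinuumYM4Torus` is or could be derived from it through the headlines (their binder `hB`); with no live component every
H3-side field is VACUOUS BY DESIGN and the numerator fields hold on a fake six-term expansion of the toy's own partition
function — inhabiting the record on `toyData` is not inhabiting it on Bałaban's data.  What the inhabitant CERTIFIES
(leaf-01 g34's wording, C-ne7bleaf01g34-10 INFO-2, adopted): the record's FIELD TYPES are JOINTLY SATISFIABLE at toy letters
with `liveCV = ∅` — «inhabitable» = «no field unsatisfiable as typed», not «readings realised non-trivially».  Proves nothing of Bałaban's; every
R∕S field of `HistReadData` stays a HYPOTHESIS of the assembly for real data; BY-NAME EFFECT ON THE WALL: NONE; headline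
p224237 ∕ END v3.1′ ∕ W∕V∕VS headlines UNCHANGED; NE7b NOT proved; spine 0∕9.  HONEST DEPENDENCY (cell): continuum YM on
T⁴ ⇐ BetaPertH ∧ nine spine estimates (0/9 proved); BetaPertH ⇐ (D1) ∧ (D4) ∧ CAP+tail; G-an2-4 gates asym, D1 and NE2/3/4.
Unchanged here.
-/

open Finset MeasureTheory
open Literature.MathematicalPhysics.QuantumFieldTheory.Balaban1983to89
open Literature.MathematicalPhysics.QuantumFieldTheory.Balaban1983to89.B16SProfile (DropCtl)
open T4PersistenceDictionary T4PersistentHistoryCount T4BankedInduction T4PrintedShapeBanking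
open T4WeightBudget T4GlobalDenominator T4LiveClassFibration T4LiveStructureGas T4LiveGasToTerms T4RecordPriceSeam
open T4PartnerMultiplicity T4IndicatorShell T4MatchingAssembly T4MatchingClosure T4MatchingClosureSocket T4Continuum
open T4StabilitySocket T4BranchingRecordsGas T4TaggedShapeBanking T4CanonicalMenus T4RenewalChains
open Summit.QuantumFields.BalabanUV.T4Continuum.HistoryFlow Summit.QuantumFields.BalabanUV.T4Continuum.HistoryGen
open Summit.QuantumFields.BalabanUV.T4Continuum.HistoryAdmissible
open Summit.QuantumFields.BalabanUV.T4Continuum.HistoryGenealogyExtraction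
open Summit.QuantumFields.BalabanUV.T4Continuum.HistoryGenealogyRealise
open Summit.QuantumFields.BalabanUV.T4Continuum.HistoryGenealogyInstantiate
open Summit.QuantumFields.BalabanUV.T4Continuum.HistoryGenealogyPedigree
open Summit.QuantumFields.BalabanUV.T4Continuum.HistoryAssemblyPedigree Summit.QuantumFields.BalabanUV.T4Continuum.HistoryAssemblyTerms
open Summit.QuantumFields.BalabanUV.T4Continuum.HistoryAssemblyMult Summit.QuantumFields.BalabanUV.T4Continuum.HistoryAssemblyMultKey
open Summit.QuantumFields.BalabanUV.T4Continuum.HistoryAssemblyRealiseRun Summit.QuantumFields.BalabanUV.T4Continuum.HistorySocketTH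
open Summit.QuantumFields.BalabanUV.T4Continuum.HistoryRealiseDistinct
open Summit.QuantumFields.BalabanUV.T4Continuum.HistoryRealiseCellsRunApexT3bWTVS
open Summit.QuantumFields.BalabanUV.T4Continuum.B16HistoryIndexedRepr
open Summit.QuantumFields.BalabanUV.T4Continuum.B16HistoryIndexedTrunc
open Summit.QuantumFields.BalabanUV.T4Continuum.HistoryBankingLE Summit.QuantumFields.BalabanUV.T4Continuum.HistoryBankingVolumePlug
open Summit.QuantumFields.BalabanUV.T4Continuum.HistoryConstants Summit.QuantumFields.BalabanUV.T4Continuum.HistoryBankingDiscountCharge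
open Summit.QuantumFields.BalabanUV.T4Continuum.HistoryBankingCreditRead Summit.QuantumFields.BalabanUV.T4Continuum.HistoryBankingFibreRoom
open Summit.QuantumFields.BalabanUV.T4Continuum.HistoryPriceNodeSum Summit.QuantumFields.BalabanUV.T4Continuum.HistoryPriceKeys
open Summit.QuantumFields.BalabanUV.T4Continuum.HistoryRealiseCellsRunSupplyWTVS
open Summit.QuantumFields.BalabanUV.T4Continuum.HistoryRealiseCellsRunSupplyKeysWTVS
open Summit.QuantumFields.BalabanUV.T4Continuum.HistoryRealiseCellsRunSupplyWTVSSanity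
open Summit.QuantumFields.BalabanUV.T4Continuum.HistoryRealiseCellsRunSupplyKeysWTVSSanity
open Summit.QuantumFields.BalabanUV.T4Continuum.HistoryRealiseCellsRunAssemblyWTVSData
open Summit.QuantumFields.BalabanUV.T4Continuum.HistoryRealiseCellsRunAssemblyWTVS
open Literature.MathematicalPhysics.QuantumFieldTheory.Balaban1983to89.T4FiniteEpsInhabited
open Missing AveragingRT T4Continuum T4StabilitySocket T4MatchingClosure T4IndicatorShell T4LiveClassFibration
open T4RenewalChains T4PersistenceDictionary T4BranchingRecordsGas T4PrintedShapeBanking T4TaggedShapeBanking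
open Summit.QuantumFields.BalabanUV.T4Continuum.HistoryAssemblyTerms
open Summit.QuantumFields.BalabanUV.T4Continuum.HistorySocketTH
open Summit.QuantumFields.BalabanUV.T4Continuum.HistoryRealiseCellsRunApexWitness
open Summit.QuantumFields.BalabanUV.T4Continuum.HistoryRealiseCellsRunApexT3bWTVSL

namespace Summit.QuantumFields.BalabanUV.T4Continuum.HistoryRealiseCellsRunAssemblyWTVSSanity

noncomputable section

open B16HistoryIndexedRepr.Sanity B16HistoryIndexedRepr.SanityInput HistoryConstants.Sanity

set_option synthInstance.maxSize 1024

section ToyData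

variable (F : T4Family) (G : Type) [GaugeGroup G] [MeasurableSpace G] [HaarData G] [RegularGaugeGroup G]

/-! ## §5 The toy datum's letters: couplings `e^{−1}`, (2.5) at exponent `1`, the dressed generating function -/

/-- the bare couplings `g₀ ≡ e^{−1}` of the toy runs [decided toy] -/
def gE : ℕ → ℝ := fun _ => Real.exp (-1)

omit [GaugeGroup G] [MeasurableSpace G] [HaarData G] [RegularGaugeGroup G] in
/-- `log gE⁻² = 2` [decided toy] -/
theorem log_gE_inv_sq (K : ℕ) : Real.log ((gE K) ^ 2)⁻¹ = 2 := by
  have h : ((gE K) ^ 2)⁻¹ = Real.exp 2 := by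
    rw [gE, sq, ← Real.exp_add, ← Real.exp_neg]
    norm_num
  rw [h, Real.log_exp]

/-- **(2.5) ON THE TOY DATUM**: along the constant flow `g ≡ e^{−1}` the size with exponent `1` is exactly `F.L = F.L¹`
(`2 ≤ F.L`, and `F.L⁰ = 1 < 2` rules out the exponent `0`) — FILE 1's `isRj` at the toy reading's `R ≡ F.L`. [decided toy] -/
theorem isRj_toyData (K s : ℕ) : B14.IsRj F.L 1 (((toyData F G).C ⟨K, F.m, gE K⟩).flow.g s) F.L := by
  rw [toy_flow_g]
  refine ⟨1, (pow_one _).symm, ?_, fun s' hs' => ?_⟩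
  · rw [pow_one, log_gE_inv_sq]
    exact_mod_cast two_le_L F
  · rw [pow_one, log_gE_inv_sq] at hs'
    rcases Nat.eq_zero_or_pos s' with h | h
    · subst h
      norm_num at hs'
    · exact h

/-- the toy's averagings are measurable (part 2's `hM`) [decided toy] -/
theorem avgMeasurable_toyData : (toyData F G).AvgMeasurable := measurable_toyAv F G

/-- the toy's initial density is the Boltzmann weight `e^{−A∕g²}` (normalisation constant `1`) [decided toy] -/
theorem dens_toyData_zero (K : ℕ) (g : ℝ) (U : GaugeField (F.P K) 0 G) :
    (toyData F G).dens K g 0 U = boltzmann (F.P K) (g⁻¹ ^ 2) U := rfl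

/-- **AT SOURCE `0` THE DRESSED GENERATING FUNCTION IS AT MOST `1`** (any string): `∫ e⁰ · e^{−A∕g²} dU ≤ ∫ 1 dU = 1`
on the probability Haar measure. [decided toy] -/
theorem ZD_toyData_zero_le_one (g₀ : ℕ → ℝ) (os : List (ULoop F)) (K : ℕ) : ZD (toyData F G) g₀ os K 0 ≤ 1 := by
  have h1 : ZD (toyData F G) g₀ os K 0 = ∫ U, (toyData F G).dens K (g₀ K) 0 U ∂fieldMeasure (F.P K) 0 G := by
    unfold ZD
    exact integral_congr_ae (Filter.Eventually.of_forall fun U => by simp)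
  rw [h1]
  calc ∫ U, (toyData F G).dens K (g₀ K) 0 U ∂fieldMeasure (F.P K) 0 G ≤ ∫ _U, (1 : ℝ) ∂fieldMeasure (F.P K) 0 G :=
        integral_mono (integrable_dens_zero (toyData F G) K (g₀ K)) (integrable_const 1)
          fun U => boltzmann_le_one (F.P K) (sq_nonneg _) U
    _ = 1 := by simp

/-- **FOR THE EMPTY STRING THE SOURCE FACTORS OUT**: `ZD … [] K t = e^t · ZD … [] K 0` (product observable `1`). [decided toy] -/
theorem ZD_toyData_nil (g₀ : ℕ → ℝ) (K : ℕ) (t : ℝ) :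
    ZD (toyData F G) g₀ ([] : List (ULoop F)) K t = Real.exp t * ZD (toyData F G) g₀ ([] : List (ULoop F)) K 0 := by
  simp only [ZD, prodObs_nil, mul_one, Real.exp_zero, one_mul]
  exact integral_const_mul _ _

/-- hence part 2's K-UNIFORM ENVELOPE `hZ` at `Zi := e` on the source disc [decided toy] -/
theorem ZD_toyData_le (g₀ : ℕ → ℝ) : ∀ K t, |t| ≤ 1 → ZD (toyData F G) g₀ ([] : List (ULoop F)) K t ≤ Real.exp 1 := by
  intro K t ht
  rw [ZD_toyData_nil]
  have h0 := (ZD_pos (toyData F G) (avgMeasurable_toyData F G) g₀ ([] : List (ULoop F)) K 0).le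
  calc Real.exp t * ZD (toyData F G) g₀ ([] : List (ULoop F)) K 0 ≤ Real.exp 1 * 1 :=
        mul_le_mul (Real.exp_le_exp.2 ((le_abs_self t).trans ht)) (ZD_toyData_zero_le_one F G g₀ _ K) h0
          (Real.exp_pos 1).le
    _ = Real.exp 1 := mul_one _

/-- **THE TWO RUNS' GENERATING FUNCTIONS DIFFER BY A SOURCE-FREE FACTOR** (`budget_toyR`'s displayed input, DECIDED on the
toy): `ZD … (K+1) t = e^{ν K} · ZD … K t` with `ν K := log (ZD … (K+1) 0 ∕ ZD … K 0)`. [decided toy] -/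
theorem ZD_toyData_succ (g₀ : ℕ → ℝ) : ∀ K t, |t| ≤ 1 →
    ZD (toyData F G) g₀ ([] : List (ULoop F)) (K + 1) t =
      Real.exp (Real.log (ZD (toyData F G) g₀ ([] : List (ULoop F)) (K + 1) 0 /
          ZD (toyData F G) g₀ ([] : List (ULoop F)) K 0)) * ZD (toyData F G) g₀ ([] : List (ULoop F)) K t := by
  intro K t _
  have h0 := ZD_pos (toyData F G) (avgMeasurable_toyData F G) g₀ ([] : List (ULoop F)) K 0
  have h1 := ZD_pos (toyData F G) (avgMeasurable_toyData F G) g₀ ([] : List (ULoop F)) (K + 1) 0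
  rw [Real.exp_log (div_pos h1 h0), ZD_toyData_nil F G g₀ (K + 1) t, ZD_toyData_nil F G g₀ K t]
  field_simp

/-! ## §6 The record and the witnesses on the toy datum — no hypothesis -/

/-- **`HistReadData` IS INHABITED — ALL 103 FIELDS, NO HYPOTHESIS** — on the toy datum × the no-region toy reading, at
couplings `e^{−1}`, empty string, exponent `1`, floor `1`, site budget `0`, NE7 class constants `ν K`, zero shells ∕
radii ∕ rates (part 2's `histReadData₃` with every displayed input discharged by §5). [decided toy] -/
theorem nonempty_histReadData_toyData (θv : ℝ) (n : ℕ) (hn : 0 < n) :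
    Nonempty (HistReadData (toyData F G) C₂ O₁ θv 1 1 n hn gE ([] : List (ULoop F)) Isk Isk (fun _ => Unit) μ₀
      (fun _ => GoodClass.top Unit) (fun _ => Unit) μ₀ (fun _ => GoodClass.top Unit)) :=
  ⟨histReadData₃ (toyData F G) (avgMeasurable_toyData F G) θv 1 n hn gE ([] : List (ULoop F)) (ZD_toyData_le F G gE)
    (fun K s _ => isRj_toyData F G K s) (c₀ := 1) (n₁ := 0) one_pos (fun K => (smallFieldMass_toy F G K _).symm.le)
    (fun K => (smallFieldMass_toy F G (K + 1) _).symm.le) (fun K => by simp) (fun K => by simp) (shell_toyR _)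
    (budget_toyR (fun K t _ => ZD_pos (toyData F G) (avgMeasurable_toyData F G) gE _ K t) _ (ZD_toyData_succ F G gE) _)
    summable_zero summable_zero summable_zero summable_zero⟩

/-- **FILE 2's END ON IT: A VS-WITNESS ON THE TOY DATUM THROUGH THE ASSEMBLY ROAD — no hypothesis.** [decided toy] -/
theorem nonempty_countRoadWitnessT3bWTVS_toyData (θv : ℝ) (n : ℕ) (hn : 0 < n) :
    Nonempty (CountRoadWitnessT3bWTVS (toyData F G) C₂ O₁ θv 1 1 n hn gE ([] : List (ULoop F)) (HIndex.Idx Isk)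
      (ℕ × Lab 1) (Lab 1)) :=
  (nonempty_histReadData_toyData F G θv n hn).elim fun Dd => nonempty_countRoadWitnessT3bWTVS_of_histReading Dd

/-- **… AND AN L-WITNESS** (the owner's R-OWNER-48-1 L3a embedding `nonempty_countRoadWitnessT3bWTVSL_of`, p283603). [decided toy] -/
theorem nonempty_countRoadWitnessT3bWTVSL_toyData (θv : ℝ) (n : ℕ) (hn : 0 < n) :
    Nonempty (CountRoadWitnessT3bWTVSL (toyData F G) C₂ O₁ θv 1 1 n hn gE ([] : List (ULoop F)) (HIndex.Idx Isk)
      (ℕ × Lab 1) (Lab 1)) :=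
  nonempty_countRoadWitnessT3bWTVSL_of (nonempty_countRoadWitnessT3bWTVS_toyData F G θv n hn)

/-- HONESTY CERTIFICATE (leaf-09's, re-read here): (B) FAILS on the toy datum, so no headline instance follows from these
witnesses (their binder `hB`). [decided toy] -/
example : ¬ B16.EndStatementBPrinted (toyData F G).C := not_endStatementBPrinted_toy F G

end ToyData

end

end Summit.QuantumFields.BalabanUV.T4Continuum.HistoryRealiseCellsRunAssemblyWTVSSanity
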